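import Summits.ResolutionOfSingularities.ResolutionOfSingularities.Theses.FoliationDescent
import Summits.ResolutionOfSingularities.ResolutionOfSingularities.Theorems.LogCanQuotLU.Negative.Transport
import Literature.AlgebraicGeometry.Resolution.DerivativeIdealsLocalization
import Literature.AlgebraicGeometry.Resolution.TranscendenceDefect
import Mathlib.Algebra.Field.ZMod
import Mathlib.Algebra.CharP.Two
import HarnessLib

/-!
# `LogCanQuotLU` — negative lemmas, part IV: the finiteness hypotheses `S'.FG` and
# `IsFractionRing S' K` are load-bearing FOR TRUTH — with either deleted the crux is FALSE

Support (negative) lemmas for crux `stmt-ResolutionOfSingularities-17082`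
(`Summit.ResolutionOfSingularities.ResolutionOfSingularities.Theses.FoliationDescent.LogCanQuotLU`,
route `FoliationDescent`, crux #3 "log-canonical quotients uniformize"), filed by the standing
disprover (cdisprove cycle 1; work file `Cruxes/LogCanQuotLU/Disproof.lean`; companions
`Negative/WithoutRegularTop.lean`, `Negative/WithoutGNeZero.lean`, `Negative/WithoutDichotomy.lean`).
This file declares NO definition and NO declaration concludes the route decl positively.

`Cruxes/LogCanQuotLU/Disproof.lean` §2 shows that NONE of the foliation hypotheses of the crux is
load-bearing for truth: the crux follows from relative local uniformization of the constant field
`K^D`, which is finitely generated over `k` BECAUSE `K = Frac S'` with `S'` finitely generated.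
Here is the converse certificate: BOTH finiteness hypotheses ARE load-bearing for truth.

The witness (shared): `p = 2`, `k = 𝔽₂`, `K = 𝔽₂(X₀, X₁, X₂, …)` (fraction field of
`MvPolynomial ℕ 𝔽₂`), `O = K` (the trivial valuation: every local ring at the centre is a field,
`isRegularLocalRing_centre_of_forall_mem`), `D = ∂/∂X₀` extended to `K`
(`exists_derivation_witness`: `D X₀ = 1`, `D X_{i+1} = 0`, and `D ∘ D = 0` because `D ∘ D` is a
derivation in characteristic `2` killing `𝔽₂[X]` — `∂₀²(a X^u) = a u₀(u₀-1) X^{u-2e₀}` with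
`u₀(u₀-1)` even — hence killing `K`; so `D` is `2`-closed with `c = 0`), `g = 1`, `R = k`. The
constants contain the infinite algebraically independent family `X₁, X₂, …`, so NO finitely
generated `A` has `Frac A ⊇ K^D` (`not_exists_fg_model_of_constants`: `trdeg_k k(A) < ℵ₀`, tree
`trdeg_lt_aleph0_of_fg`). Then:

* `logCanQuotLU_false_without_fg` — delete ONLY `S'.FG`: take `S' = K` (`Frac S' = K` holds).
* `logCanQuotLU_false_without_isFractionRing` — delete ONLY `IsFractionRing S' K`: take the
  finitely generated `S' = k[X₀]`, mapped into itself by `D`, non-singular since `D X₀ = 1`.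

## Sources
* N. Jacobson, *Lectures in Abstract Algebra* III (1964), Ch. IV §8 (`p`-closed derivations and
  their constants). [folklore computation here]
-/

noncomputable section

set_option linter.dupNamespace false -- mandated namespace of this single-conjunct summit

open IsLocalRing MvPolynomial
open Literature.AlgebraicGeometry.Resolution

namespace Summit.ResolutionOfSingularities.ResolutionOfSingularities.Theorems.LogCanQuotLU.Negative

/-- `∂₀ ∘ ∂₀ = 0` on `𝔽₂[Xᵢ : i ∈ ℕ]` (`∂₀²(a X^u) = a u₀ (u₀ - 1) X^{u - 2e₀}` and `u₀(u₀-1)` is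
even). [folklore] -/
theorem pderiv_zero_pderiv_zero (f : MvPolynomial ℕ (ZMod 2)) : pderiv 0 (pderiv 0 f) = 0 := by
  refine MvPolynomial.induction_on' f (fun u a => ?_) (fun p q hp hq => ?_)
  · rw [pderiv_monomial, pderiv_monomial, Finsupp.tsub_apply, Finsupp.single_eq_same]
    have h : a * ((u 0 : ℕ) : ZMod 2) * (((u 0 - 1 : ℕ)) : ZMod 2) = 0 := by
      rw [mul_assoc, ← Nat.cast_mul, ZMod.natCast_eq_zero_iff_even.mpr (Nat.even_mul_pred_self _),
        mul_zero]
    rw [h, map_zero]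
  · rw [map_add, map_add, hp, hq, add_zero]

/-- **The witness derivation `D = ∂/∂X₀` of `K = 𝔽₂(X₀, X₁, …)`**: `D X₀ = 1`, `D X_{i+1} = 0`,
and `D ∘ D = 0` (a derivation in characteristic `2` killing `𝔽₂[X]`, hence `K`). [folklore] -/
theorem exists_derivation_witness :
    ∃ D : Derivation (ZMod 2) (FractionRing (MvPolynomial ℕ (ZMod 2)))
        (FractionRing (MvPolynomial ℕ (ZMod 2))),
      D (algebraMap (MvPolynomial ℕ (ZMod 2)) _ (X 0)) = 1 ∧
      (∀ i : ℕ, D (algebraMap (MvPolynomial ℕ (ZMod 2)) _ (X (i + 1))) = 0) ∧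
      ∀ x, D (D x) = 0 := by
  classical
  let k : Type := ZMod 2
  let A : Type := MvPolynomial ℕ k
  let K : Type := FractionRing A
  haveI : CharP K 2 := charP_of_injective_algebraMap (algebraMap k K).injective 2
  obtain ⟨D, hD⟩ :=
    exists_derivation_extend_of_isLocalization k K (nonZeroDivisors A) (pderiv 0 : Derivation k A A)
  refine ⟨D, ?_, fun i => ?_, ?_⟩
  · rw [hD, pderiv_X, Pi.single_eq_same, map_one]
  · rw [hD, pderiv_X_of_ne (Nat.succ_ne_zero i), map_zero]
  · -- `D ∘ D` is a derivation (characteristic `2`) killing `𝔽₂[X]`, hence `K`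
    let D2 : Derivation k K K :=
      { toLinearMap := (D : K →ₗ[k] K).comp (D : K →ₗ[k] K)
        map_one_eq_zero' := by simp
        leibniz' := fun a b => by
          simp only [LinearMap.coe_comp, Function.comp_apply, Derivation.coeFn_coe,
            Derivation.leibniz, map_add, smul_eq_mul]
          have h2 : D b * D a + D a * D b = 0 := by
            rw [mul_comm (D b) (D a)]
            exact CharTwo.add_self_eq_zero _
          linear_combination h2 }
    have hD2 : ∀ x : K, D2 x = D (D x) := fun x => rfl
    have hD2A : ∀ a : A, D2 (algebraMap A K a) = 0 := fun a => by
      rw [hD2, hD, hD, pderiv_zero_pderiv_zero, map_zero]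
    intro x
    obtain ⟨a, b, -, rfl⟩ := IsFractionRing.div_surjective (A := A) x
    rw [← hD2, Derivation.leibniz_div, hD2A, hD2A, smul_zero, smul_zero, sub_zero, smul_zero]

/-- **No finitely generated algebra has all of `X₁, X₂, …` in its fraction field**: if `D` kills
every `X_{i+1}` then there is no finitely generated `𝔽₂`-subalgebra `B` of `K = 𝔽₂(X₀, X₁, …)`
with every `D`-constant a quotient of elements of `B` (`X₁, X₂, …` would be an infinite
algebraically independent family in the finitely generated field `k(B)`, of finite transcendence
degree). [folklore] -/
theorem not_exists_fg_model_of_constants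
    (D : Derivation (ZMod 2) (FractionRing (MvPolynomial ℕ (ZMod 2)))
      (FractionRing (MvPolynomial ℕ (ZMod 2))))
    (hD : ∀ i : ℕ, D (algebraMap (MvPolynomial ℕ (ZMod 2)) _ (X (i + 1))) = 0) :
    ¬ ∃ B : Subalgebra (ZMod 2) (FractionRing (MvPolynomial ℕ (ZMod 2))), B.FG ∧
        ∀ x, D x = 0 → ∃ a b, a ∈ B ∧ b ∈ B ∧ b ≠ 0 ∧ x = a / b := by
  classical
  rintro ⟨B, ⟨t, ht⟩, hBfrac⟩
  let k : Type := ZMod 2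
  let A : Type := MvPolynomial ℕ k
  let K : Type := FractionRing A
  let ι : A →ₐ[k] K := IsScalarTower.toAlgHom k A K
  have hι : Function.Injective ι := IsFractionRing.injective A K
  -- `k(B)` is a finitely generated field
  set F : IntermediateField k K := IntermediateField.adjoin k (t : Set K) with hF
  have hBF : B ≤ F.toSubalgebra := by
    rw [← ht]
    exact IntermediateField.algebra_adjoin_le_adjoin k _
  have hFfg : F.FG := IntermediateField.fg_adjoin_finset t
  haveI : Algebra.EssFiniteType k F := IntermediateField.essFiniteType_iff.mpr hFfg
  have hFtop : (⊤ : IntermediateField k F).FG := IntermediateField.fg_top_iff.mpr ‹_›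
  -- the constants `yᵢ = X_{i+1}` lie in `F` and are algebraically independent over `k`
  let y : ℕ → K := fun i => algebraMap A K (X (i + 1))
  have hyF : ∀ i, y i ∈ F := fun i => by
    obtain ⟨a, b, ha, hb, -, hab⟩ := hBfrac (y i) (hD i)
    rw [hab]
    exact div_mem (hBF ha) (hBF hb)
  have hy : AlgebraicIndependent k y :=
    ((algebraicIndependent_X ℕ k).comp Nat.succ Nat.succ_injective).map' (f := ι) hι
  let y' : ℕ → F := fun i => ⟨y i, hyF i⟩
  have hy' : AlgebraicIndependent k y' := AlgebraicIndependent.of_comp F.val hy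
  -- `ℵ₀ ≤ trdeg_k F < ℵ₀`
  have h1 := hy'.lift_cardinalMk_le_trdeg
  rw [Cardinal.mk_nat, Cardinal.lift_aleph0, Cardinal.lift_id] at h1
  exact (h1.trans_lt (trdeg_lt_aleph0_of_fg hFtop)).false

/-- Over the trivial valuation (`O = K`) EVERY subalgebra is regular at the centre: the centre is
`(0)` and its local ring is a field. [folklore] -/
theorem isRegularLocalRing_centre_of_forall_mem {k K : Type} [Field k] [Field K] [Algebra k K]
    (O : ValuationSubring K) (hOmem : ∀ x : K, x ∈ O) (S' : Subalgebra k K)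
    (h' : S'.toSubring ≤ O.toSubring) :
    IsRegularLocalRing (Localization.AtPrime
      (Ideal.comap (Subring.inclusion h') (IsLocalRing.maximalIdeal O))) := by
  have hP : Ideal.comap (Subring.inclusion h') (maximalIdeal O) = ⊥ := by
    refine le_bot_iff.mp fun a ha => ?_
    rw [Ideal.mem_comap, IsLocalRing.mem_maximalIdeal, mem_nonunits_iff] at ha
    rw [Ideal.mem_bot]
    by_contra hne
    have hane : (a : K) ≠ 0 := fun h0 => hne (Subtype.ext h0)
    exact ha (IsUnit.of_mul_eq_one ⟨(a : K)⁻¹, hOmem _⟩ (Subtype.ext (mul_inv_cancel₀ hane)))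
  haveI : (⊥ : Ideal S'.toSubring).IsPrime := Ideal.isPrime_bot
  exact isRegularLocalRing_localization_atPrime_congr hP.symm isRegularLocalRing_localization_bot

/-- **`S'.FG` is load-bearing for truth: `LogCanQuotLU` with ONLY the finite generation of `S'`
deleted is FALSE** (witness `K = 𝔽₂(X₀, X₁, …)`, `S' = O = K`, `D = ∂/∂X₀`, `g = 1`, `R = 𝔽₂`).
[folklore] -/
theorem logCanQuotLU_false_without_fg :
    ¬ (∀ p : ℕ, p.Prime → ∀ (k K : Type) [Field k] [CharP k p] [PerfectField k] [Field K]
        [Algebra k K] (O : ValuationSubring K) (S' : Subalgebra k K)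
        (h' : S'.toSubring ≤ O.toSubring) (D : Derivation k K K) (g : K) (R : Subalgebra k K),
        IsFractionRing S' K →
        IsRegularLocalRing (Localization.AtPrime
          (Ideal.comap (Subring.inclusion h') (IsLocalRing.maximalIdeal O))) →
        D ≠ 0 → (∃ c : K, ∀ x : K, (⇑D)^[p] x = c * D x) → g ≠ 0 →
        (∀ x : K, (∃ a b : K, a ∈ S' ∧ b ∈ S' ∧ b ≠ 0 ∧ b⁻¹ ∈ O ∧ x = a / b) →
          ∃ a b : K, a ∈ S' ∧ b ∈ S' ∧ b ≠ 0 ∧ b⁻¹ ∈ O ∧ (g • D) x = a / b) →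
        ((∃ x : K, (∃ a b : K, a ∈ S' ∧ b ∈ S' ∧ b ≠ 0 ∧ b⁻¹ ∈ O ∧ x = a / b) ∧
            (g • D) x ≠ 0 ∧ ((g • D) x)⁻¹ ∈ O) ∨
          (∃ u : K, (∃ a b : K, a ∈ S' ∧ b ∈ S' ∧ b ≠ 0 ∧ b⁻¹ ∈ O ∧ u = a / b) ∧ u ≠ 0 ∧
            u⁻¹ ∈ O ∧ ∀ x : K, (⇑(g • D))^[p] x = u * (g • D) x)) →
        R.FG → R ≤ S' → (∀ x ∈ R, D x = 0) →
        ∃ (A : Subalgebra k K) (hA : A.toSubring ≤ O.toSubring), R ≤ A ∧ A.FG ∧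
          (∀ x ∈ A, D x = 0) ∧
          (∀ x : K, D x = 0 → ∃ a b : K, a ∈ A ∧ b ∈ A ∧ b ≠ 0 ∧ x = a / b) ∧
          IsRegularLocalRing (Localization.AtPrime
            (Ideal.comap (Subring.inclusion hA) (IsLocalRing.maximalIdeal O)))) := by
  intro h
  classical
  let k : Type := ZMod 2
  let A : Type := MvPolynomial ℕ k
  let K : Type := FractionRing A
  obtain ⟨D, hDX0, hDXsucc, hDD⟩ := exists_derivation_witness
  have hD0 : D ≠ 0 := by
    intro h0
    rw [h0, Derivation.zero_apply] at hDX0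
    exact zero_ne_one hDX0
  have hDpc : ∃ c : K, ∀ x : K, (⇑D)^[2] x = c * D x := ⟨0, fun x => by rw [zero_mul]; exact hDD x⟩
  -- `S' = O = K`, `g = 1`, `R = k`
  let O : ValuationSubring K := ⊤
  have hOmem : ∀ x : K, x ∈ O := fun _ => trivial
  let S' : Subalgebra k K := ⊤
  have h' : S'.toSubring ≤ O.toSubring := fun x _ => hOmem x
  have hS'fr : IsFractionRing S' K :=
    IsFractionRing.of_field S' K fun z => ⟨⟨z, Algebra.mem_top⟩, 1, by simp⟩
  have hmemSc : ∀ x : K, ∃ a b : K, a ∈ S' ∧ b ∈ S' ∧ b ≠ 0 ∧ b⁻¹ ∈ O ∧ x = a / b := fun x =>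
    ⟨x, 1, Algebra.mem_top, Algebra.mem_top, one_ne_zero, hOmem _, (div_one x).symm⟩
  have hpres : ∀ x : K, (∃ a b : K, a ∈ S' ∧ b ∈ S' ∧ b ≠ 0 ∧ b⁻¹ ∈ O ∧ x = a / b) →
      ∃ a b : K, a ∈ S' ∧ b ∈ S' ∧ b ≠ 0 ∧ b⁻¹ ∈ O ∧ ((1 : K) • D) x = a / b :=
    fun x _ => hmemSc _
  have hcase : (∃ x : K, (∃ a b : K, a ∈ S' ∧ b ∈ S' ∧ b ≠ 0 ∧ b⁻¹ ∈ O ∧ x = a / b) ∧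
        ((1 : K) • D) x ≠ 0 ∧ (((1 : K) • D) x)⁻¹ ∈ O) ∨
      (∃ u : K, (∃ a b : K, a ∈ S' ∧ b ∈ S' ∧ b ≠ 0 ∧ b⁻¹ ∈ O ∧ u = a / b) ∧ u ≠ 0 ∧
        u⁻¹ ∈ O ∧ ∀ x : K, (⇑((1 : K) • D))^[2] x = u * ((1 : K) • D) x) :=
    Or.inl ⟨algebraMap A K (X 0), hmemSc _, by rw [one_smul, hDX0]; exact one_ne_zero, hOmem _⟩
  have hRconst : ∀ x ∈ (⊥ : Subalgebra k K), D x = 0 := by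
    intro x hx
    obtain ⟨c, rfl⟩ := Algebra.mem_bot.mp hx
    exact D.map_algebraMap c
  -- the crux WITHOUT `S'.FG`
  obtain ⟨B, -, -, hBfg, -, hBfrac, -⟩ :=
    h 2 Nat.prime_two k K O S' h' D 1 ⊥ hS'fr (isRegularLocalRing_centre_of_forall_mem O hOmem S' h')
      hD0 hDpc one_ne_zero hpres hcase Subalgebra.fg_bot bot_le hRconst
  exact not_exists_fg_model_of_constants D hDXsucc ⟨B, hBfg, hBfrac⟩

/-- **`IsFractionRing S' K` is load-bearing for truth: `LogCanQuotLU` with ONLY `Frac S' = K`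
deleted is FALSE** (same witness, but `S' = k[X₀] ⊆ K = 𝔽₂(X₀, X₁, …)`, finitely generated,
mapped into itself by `D = ∂/∂X₀`, non-singular since `D X₀ = 1`). [folklore] -/
theorem logCanQuotLU_false_without_isFractionRing :
    ¬ (∀ p : ℕ, p.Prime → ∀ (k K : Type) [Field k] [CharP k p] [PerfectField k] [Field K]
        [Algebra k K] (O : ValuationSubring K) (S' : Subalgebra k K)
        (h' : S'.toSubring ≤ O.toSubring) (D : Derivation k K K) (g : K) (R : Subalgebra k K),
        S'.FG →
        IsRegularLocalRing (Localization.AtPrime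
          (Ideal.comap (Subring.inclusion h') (IsLocalRing.maximalIdeal O))) →
        D ≠ 0 → (∃ c : K, ∀ x : K, (⇑D)^[p] x = c * D x) → g ≠ 0 →
        (∀ x : K, (∃ a b : K, a ∈ S' ∧ b ∈ S' ∧ b ≠ 0 ∧ b⁻¹ ∈ O ∧ x = a / b) →
          ∃ a b : K, a ∈ S' ∧ b ∈ S' ∧ b ≠ 0 ∧ b⁻¹ ∈ O ∧ (g • D) x = a / b) →
        ((∃ x : K, (∃ a b : K, a ∈ S' ∧ b ∈ S' ∧ b ≠ 0 ∧ b⁻¹ ∈ O ∧ x = a / b) ∧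
            (g • D) x ≠ 0 ∧ ((g • D) x)⁻¹ ∈ O) ∨
          (∃ u : K, (∃ a b : K, a ∈ S' ∧ b ∈ S' ∧ b ≠ 0 ∧ b⁻¹ ∈ O ∧ u = a / b) ∧ u ≠ 0 ∧
            u⁻¹ ∈ O ∧ ∀ x : K, (⇑(g • D))^[p] x = u * (g • D) x)) →
        R.FG → R ≤ S' → (∀ x ∈ R, D x = 0) →
        ∃ (A : Subalgebra k K) (hA : A.toSubring ≤ O.toSubring), R ≤ A ∧ A.FG ∧
          (∀ x ∈ A, D x = 0) ∧
          (∀ x : K, D x = 0 → ∃ a b : K, a ∈ A ∧ b ∈ A ∧ b ≠ 0 ∧ x = a / b) ∧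
          IsRegularLocalRing (Localization.AtPrime
            (Ideal.comap (Subring.inclusion hA) (IsLocalRing.maximalIdeal O)))) := by
  intro h
  classical
  let k : Type := ZMod 2
  let A : Type := MvPolynomial ℕ k
  let K : Type := FractionRing A
  obtain ⟨D, hDX0, hDXsucc, hDD⟩ := exists_derivation_witness
  have hD0 : D ≠ 0 := by
    intro h0
    rw [h0, Derivation.zero_apply] at hDX0
    exact zero_ne_one hDX0
  have hDpc : ∃ c : K, ∀ x : K, (⇑D)^[2] x = c * D x := ⟨0, fun x => by rw [zero_mul]; exact hDD x⟩
  -- `O = K`, `S' = k[X₀]`, `g = 1`, `R = k`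
  let O : ValuationSubring K := ⊤
  have hOmem : ∀ x : K, x ∈ O := fun _ => trivial
  set x₀ : K := algebraMap A K (X 0) with hx₀
  set S' : Subalgebra k K := Algebra.adjoin k ({x₀} : Set K) with hS'
  have h' : S'.toSubring ≤ O.toSubring := fun x _ => hOmem x
  have hS'fg : S'.FG := ⟨{x₀}, by rw [Finset.coe_singleton]⟩
  have hx₀S' : x₀ ∈ S' := Algebra.subset_adjoin (Set.mem_singleton _)
  -- `D` maps `S'` into itself
  have hDS' : ∀ z ∈ S', D z ∈ S' := by
    intro z hz
    rw [hS'] at hz ⊢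
    refine Algebra.adjoin_induction (fun x hx => ?_) (fun r => ?_) (fun u v _ _ hu hv => ?_)
      (fun u v hu' hv' hu hv => ?_) hz
    · rw [Set.mem_singleton_iff.mp hx, hDX0]
      exact Subalgebra.one_mem _
    · rw [D.map_algebraMap]
      exact Subalgebra.zero_mem _
    · rw [map_add]
      exact Subalgebra.add_mem _ hu hv
    · rw [D.leibniz, smul_eq_mul, smul_eq_mul]
      exact Subalgebra.add_mem _ (Subalgebra.mul_mem _ hu' hv) (Subalgebra.mul_mem _ hv' hu)
  have hpres : ∀ x : K, (∃ a b : K, a ∈ S' ∧ b ∈ S' ∧ b ≠ 0 ∧ b⁻¹ ∈ O ∧ x = a / b) →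
      ∃ a b : K, a ∈ S' ∧ b ∈ S' ∧ b ≠ 0 ∧ b⁻¹ ∈ O ∧ ((1 : K) • D) x = a / b := by
    rintro x ⟨a, b, ha', hb, hb0, -, rfl⟩
    refine ⟨b * D a - a * D b, b * b, ?_, S'.mul_mem hb hb, mul_ne_zero hb0 hb0, hOmem _, ?_⟩
    · exact S'.sub_mem (S'.mul_mem hb (hDS' a ha')) (S'.mul_mem ha' (hDS' b hb))
    · rw [one_smul, Derivation.leibniz_div, smul_eq_mul, smul_eq_mul, smul_eq_mul, div_eq_mul_inv]
      ring
  have hcase : (∃ x : K, (∃ a b : K, a ∈ S' ∧ b ∈ S' ∧ b ≠ 0 ∧ b⁻¹ ∈ O ∧ x = a / b) ∧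
        ((1 : K) • D) x ≠ 0 ∧ (((1 : K) • D) x)⁻¹ ∈ O) ∨
      (∃ u : K, (∃ a b : K, a ∈ S' ∧ b ∈ S' ∧ b ≠ 0 ∧ b⁻¹ ∈ O ∧ u = a / b) ∧ u ≠ 0 ∧
        u⁻¹ ∈ O ∧ ∀ x : K, (⇑((1 : K) • D))^[2] x = u * ((1 : K) • D) x) :=
    Or.inl ⟨x₀, ⟨x₀, 1, hx₀S', S'.one_mem, one_ne_zero, hOmem _, (div_one x₀).symm⟩,
      by rw [one_smul, hDX0]; exact one_ne_zero, hOmem _⟩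
  have hRconst : ∀ x ∈ (⊥ : Subalgebra k K), D x = 0 := by
    intro x hx
    obtain ⟨c, rfl⟩ := Algebra.mem_bot.mp hx
    exact D.map_algebraMap c
  -- the crux WITHOUT `IsFractionRing S' K`
  obtain ⟨B, -, -, hBfg, -, hBfrac, -⟩ :=
    h 2 Nat.prime_two k K O S' h' D 1 ⊥ hS'fg (isRegularLocalRing_centre_of_forall_mem O hOmem S' h')
      hD0 hDpc one_ne_zero hpres hcase Subalgebra.fg_bot bot_le hRconst
  exact not_exists_fg_model_of_constants D hDXsucc ⟨B, hBfg, hBfrac⟩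

end Summit.ResolutionOfSingularities.ResolutionOfSingularities.Theorems.LogCanQuotLU.Negative

end
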